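import Summits.NavierStokesRegularity.NavierStokesRegularity.Theorems.ExtremiserTransienceNearExtremalTransiencePerFlowStretchingContinuity
import Summits.NavierStokesRegularity.NavierStokesRegularity.Theorems.ExtremiserTransienceZoneTransversalityDefs
import Summits.NavierStokesRegularity.NavierStokesRegularity.Theorems.ExtremiserTransiencePerFlowScaleLockOfEnstrophyRate
import Literature.Analysis.FluidPDE.BKMClassGradientContinuity
import Literature.Analysis.FluidPDE.LeraySeparationOfEnergyTools
import Literature.Analysis.FluidPDE.PeriodicLerayProfileGradient
import HarnessLib

/-!
# Crux `NearExtremalTransiencePerFlow` (stmt-NavierStokesRegularity-26567), LINE g7-β `zone_transversality`: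
# STUB Z3 `stub_efficiencyContinuous` — the minimal depletion coefficient is continuous on `(0,T)`

Theorems file (lands `--supports stmt-NavierStokesRegularity-26567`) proving the registered stub `stub_efficiencyContinuous`
of the skeleton `Cruxes/NearExtremalTransiencePerFlow/Lines/zone_transversality.lean` EXACTLY as registered (vocabulary
`IsViolator`, `IsMinimalCoeff` from `Theorems/ExtremiserTransienceZoneTransversalityDefs.lean`, verbatim the skeleton's §0).

Statement.  For a violator flow `u` on `[0,T)` (classical Leray–Hopf, rapidly decaying datum, eventual Type-I rate, no smooth
extension past `T`, per-flow conclusion false) every minimal measurable depletion coefficient `k₀` is continuous on `(0,T)`.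

Proof.  (1) NON-DEGENERACY on `[0,T)` (uses only «classical Leray–Hopf rapidly-decaying datum + no smooth extension»):
`u(t) ≢ 0` by Leray's lower blow-up rate (`DepletionLadder.PerFlow.lerayLowerRate_of_not_extends`); `Z(t) = ∫‖curl u(t)‖² > 0`
(`enstrophy_pos`: `Z = 0` ⇒ `∫|∇u|²_F = 0` by `integral_frobeniusNormSq_fderiv_eq_integral_norm_curl_sq` ⇒ `u(t)` constant and
square integrable ⇒ `u(t) ≡ 0`); `P(t) = ∫|∇curl u(t)|²_F > 0` (`palinstrophy_pos`: `P = 0` ⇒ `curl u(t)` constant and square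
integrable ⇒ `Z = 0`).  The `L²` bounds come from Tao's class on closed sub-slabs (`RungReynoldsOne.stub_taoCover`).
(2) IDENTIFICATION (`minimalCoeff_eq`, real core `minimal_eq_ratio`): the flow-wise clause at the least bound
`N(t) = sup_x‖u(t,x)‖` and minimality at `c = |J|/(N√Z√P)` pin `k₀(t) = |J(t)|/(N(t)√Z(t)√P(t))` on `[0,T)`,
`J(t) = ∫⟪curl u(t), Du(t) curl u(t)⟫`.  (3) CONTINUITY of `J`, `N` (`continuousOn_stretching`, `continuousOn_iSup_norm`, file
`…PerFlowStretchingContinuity`) and of `Z`, `P` (`DepletionLadder.PerFlow.continuousOn_enstrophy_palinstrophy`) on `[0,T)`, with a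
positive denominator, gives continuity of `k₀` on `[0,T) ⊇ (0,T)`.
HONEST FRAMING: time regularity of a functional of a hypothetical Type-I singular flow; nothing about Navier–Stokes regularity
or blow-up is proved; no summit is proved by a line. [folklore]
-/

noncomputable section

open Set Filter Topology MeasureTheory Function
open scoped InnerProductSpace RealInnerProductSpace ENNReal NNReal ContDiff
open Literature.Analysis.FluidPDE

namespace Summit.NavierStokesRegularity.NavierStokesRegularity.Theorems.NearExtremalTransiencePerFlow.ZoneTransversality

-- the summit's namespace `Summit.NavierStokesRegularity.NavierStokesRegularity` repeats the problem name by convention (D-0017)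
set_option linter.dupNamespace false

/-! ### Non-degeneracy of the slices of a non-extending flow -/

/-- A constant field on `ℝ³` with `∫ ‖f‖² < ∞` vanishes (`volume univ = ∞`). [folklore] -/
theorem eq_zero_of_const_of_lintegral_lt_top {f : EuclideanSpace ℝ (Fin 3) → EuclideanSpace ℝ (Fin 3)}
    (hconst : ∀ x y, f x = f y) (hfin : ∫⁻ x, ‖f x‖ₑ ^ 2 < ⊤) : ∀ x, f x = 0 := by
  intro x
  by_contra hx
  have hc : ∫⁻ y, ‖f y‖ₑ ^ 2 = ∫⁻ _ : EuclideanSpace ℝ (Fin 3), ‖f x‖ₑ ^ 2 :=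
    lintegral_congr fun y => by rw [hconst y x]
  rw [hc, lintegral_const, measure_univ_of_isAddLeftInvariant] at hfin
  have hne : ‖f x‖ₑ ^ 2 ≠ 0 := pow_ne_zero _ (enorm_ne_zero.2 hx)
  rw [ENNReal.mul_top hne] at hfin
  exact lt_irrefl _ hfin

/-- A continuous nonnegative integrable function with zero integral vanishes identically. [folklore] -/
theorem eq_zero_of_integral_eq_zero {g : EuclideanSpace ℝ (Fin 3) → ℝ} (hg : Continuous g) (hg0 : ∀ x, 0 ≤ g x)
    (hint : Integrable g) (hzero : ∫ x, g x = 0) : ∀ x, g x = 0 := by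
  have hae : g =ᵐ[volume] 0 := (integral_eq_zero_iff_of_nonneg (fun x => hg0 x) hint).1 hzero
  have heq : g = fun _ => 0 := (Continuous.ae_eq_iff_eq volume hg continuous_const).1 hae
  exact fun x => congrFun heq x

/-- **Every slice of a non-extending flow is non-trivial**: on `[0,T)` the velocity does not vanish identically (Leray's
lower blow-up rate `lerayLowerRate_of_not_extends`). [folklore] -/
theorem exists_norm_pos {ν T : ℝ} (hν : 0 < ν) (hT : 0 < T)
    {u : ℝ → EuclideanSpace ℝ (Fin 3) → EuclideanSpace ℝ (Fin 3)} {p : ℝ → EuclideanSpace ℝ (Fin 3) → ℝ}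
    (hsol : IsClassicalNSSolutionOn (Ico 0 T) ν 0 u p) (hLH : IsLerayHopfOn T ν 0 (u 0) u)
    (hdec : HasRapidSpatialDecay (u 0)) (hext : ¬ HasSmoothExtensionPast ν 0 u T) :
    ∀ t ∈ Ico 0 T, ∃ x, 0 < ‖u t x‖ := by
  obtain ⟨c₀, hc₀, h⟩ := DepletionLadder.PerFlow.lerayLowerRate_of_not_extends hν hT hsol hLH hdec hext
  intro t ht
  obtain ⟨x, hx⟩ := h t ht
  refine ⟨x, ?_⟩
  have h1 : 0 < c₀ * Real.sqrt ν := mul_pos hc₀ (Real.sqrt_pos.2 hν)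
  have h2 : 0 < Real.sqrt (T - t) * ‖u t x‖ := h1.trans_le hx
  exact pos_of_mul_pos_right h2 (Real.sqrt_nonneg _)

/-- The slices of the flow are bounded on `[0,T)` (Tao's class on closed sub-slabs): `BddAbove (range ‖u(t,·)‖)`. [folklore] -/
theorem bddAbove_range_norm {ν T : ℝ} (hν : 0 < ν) (hT : 0 < T)
    {u : ℝ → EuclideanSpace ℝ (Fin 3) → EuclideanSpace ℝ (Fin 3)} {p : ℝ → EuclideanSpace ℝ (Fin 3) → ℝ}
    (hsol : IsClassicalNSSolutionOn (Ico 0 T) ν 0 u p) (hLH : IsLerayHopfOn T ν 0 (u 0) u)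
    (hdec : HasRapidSpatialDecay (u 0)) : ∀ t ∈ Ico 0 T, BddAbove (range fun x => ‖u t x‖) := by
  intro t ht
  have ht' : (t + T) / 2 ∈ Ioo 0 T := ⟨by linarith [ht.1], by linarith [ht.2]⟩
  obtain ⟨q, hsolt, hut, -, -⟩ := RungReynoldsOne.stub_taoCover hν hT hsol hLH hdec ht'
  obtain ⟨B₀, -, hB₀⟩ := exists_forall_norm_le_of_hasBoundedSobolevNormsOn hsolt hut
  exact ⟨B₀, by rintro _ ⟨x, rfl⟩; exact hB₀ t ⟨ht.1, by linarith [ht.2]⟩ x⟩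

/-- **Positive enstrophy on `[0,T)`** for a non-extending flow: if `∫‖curl u(t)‖² = 0` then `Du(t) ≡ 0`
(`∫|∇u|²_F = ∫‖curl u‖²` for divergence-free `H²` fields), so `u(t)` is a constant `L²` field, i.e. `u(t) ≡ 0`,
contradicting `exists_norm_pos`. [folklore] -/
theorem enstrophy_pos {ν T : ℝ} (hν : 0 < ν) (hT : 0 < T)
    {u : ℝ → EuclideanSpace ℝ (Fin 3) → EuclideanSpace ℝ (Fin 3)} {p : ℝ → EuclideanSpace ℝ (Fin 3) → ℝ}
    (hsol : IsClassicalNSSolutionOn (Ico 0 T) ν 0 u p) (hLH : IsLerayHopfOn T ν 0 (u 0) u)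
    (hdec : HasRapidSpatialDecay (u 0)) (hext : ¬ HasSmoothExtensionPast ν 0 u T) :
    ∀ t ∈ Ico 0 T, 0 < ∫ x, ‖curl (u t) x‖ ^ 2 := by
  intro t ht
  have ht' : (t + T) / 2 ∈ Ioo 0 T := ⟨by linarith [ht.1], by linarith [ht.2]⟩
  have htc : t ∈ Icc 0 ((t + T) / 2) := ⟨ht.1, by linarith [ht.2]⟩
  obtain ⟨q, hsolt, hut, -, -⟩ := RungReynoldsOne.stub_taoCover hν hT hsol hLH hdec ht'
  have hsm : ContDiff ℝ ∞ (u t) := hsolt.contDiff_velocity htc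
  have hu2 : ContDiff ℝ 2 (u t) := hsm.of_le (by norm_cast)
  obtain ⟨C₀, hC₀⟩ := hut 0
  obtain ⟨C₁, hC₁⟩ := hut 1
  obtain ⟨C₂, hC₂⟩ := hut 2
  have h0 : ∫⁻ x, ‖u t x‖ₑ ^ 2 < ⊤ := by
    refine lt_of_le_of_lt (le_of_eq (lintegral_congr fun x => ?_)) ((hC₀ t htc).trans_lt ENNReal.coe_lt_top)
    rw [← ofReal_norm, ← ofReal_norm, norm_iteratedFDeriv_zero]
  have h1 : ∫⁻ x, ‖iteratedFDeriv ℝ 1 (u t) x‖ₑ ^ 2 < ⊤ := (hC₁ t htc).trans_lt ENNReal.coe_lt_top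
  have h2 : ∫⁻ x, ‖iteratedFDeriv ℝ 2 (u t) x‖ₑ ^ 2 < ⊤ := (hC₂ t htc).trans_lt ENNReal.coe_lt_top
  have h1' : ∫⁻ x, ‖fderiv ℝ (u t) x‖ₑ ^ 2 < ⊤ := by
    refine lt_of_le_of_lt (le_of_eq (lintegral_congr fun x => ?_)) h1
    rw [← ofReal_norm, ← norm_iteratedFDeriv_one (𝕜 := ℝ) (f := u t), ofReal_norm]
  -- integrability of the two densities
  have hcω : Continuous (curl (u t)) := continuous_curl (hsm.of_le (by norm_cast))
  have hZ0 : 0 ≤ ∫ x, ‖curl (u t) x‖ ^ 2 := integral_nonneg fun x => sq_nonneg _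
  refine lt_of_le_of_ne hZ0 fun hZ => ?_
  -- `∫ |∇u(t)|²_F = 0`, hence `∇u(t) ≡ 0`
  have hF : ∫ x, frobeniusNormSq (fderiv ℝ (u t) x) = 0 := by
    rw [integral_frobeniusNormSq_fderiv_eq_integral_norm_curl_sq hu2 (hsolt.divFree t htc) h0 h1 h2]
    exact hZ.symm
  have hcD : Continuous fun x => fderiv ℝ (u t) x := hsm.continuous_fderiv (by simp)
  have hFint : Integrable fun x => frobeniusNormSq (fderiv ℝ (u t) x) := by
    refine ((integrable_sq_norm_of_lintegral_lt_top hcD h1').const_mul 3).mono'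
      (continuous_frobeniusNormSq_fderiv hsm (by simp)).aestronglyMeasurable (ae_of_all _ fun x => ?_)
    rw [Real.norm_eq_abs, abs_of_nonneg (frobeniusNormSq_nonneg _)]
    exact BradshawTsai2017.frobeniusNormSq_le_three_mul_norm_sq (fderiv ℝ (u t) x)
  have hD0 : ∀ x, fderiv ℝ (u t) x = 0 := by
    intro x
    have hz := eq_zero_of_integral_eq_zero (continuous_frobeniusNormSq_fderiv hsm (by simp))
      (fun x => frobeniusNormSq_nonneg _) hFint hF x
    have hn : ‖fderiv ℝ (u t) x‖ ^ 2 ≤ 0 := (norm_sq_le_frobeniusNormSq _).trans hz.le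
    exact norm_eq_zero.1 (by nlinarith [norm_nonneg (fderiv ℝ (u t) x)])
  -- `u(t)` is constant, square integrable, hence zero
  have hconst : ∀ x y, u t x = u t y := is_const_of_fderiv_eq_zero (hsm.differentiable (by simp)) hD0
  have hzero := eq_zero_of_const_of_lintegral_lt_top hconst h0
  obtain ⟨x, hx⟩ := exists_norm_pos hν hT hsol hLH hdec hext t ht
  rw [hzero x, norm_zero] at hx
  exact lt_irrefl _ hx

/-- **Positive palinstrophy on `[0,T)`** for a non-extending flow: if `∫|∇curl u(t)|²_F = 0` then `curl u(t)` is a constant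
`L²` field, hence zero, contradicting `enstrophy_pos`. [folklore] -/
theorem palinstrophy_pos {ν T : ℝ} (hν : 0 < ν) (hT : 0 < T)
    {u : ℝ → EuclideanSpace ℝ (Fin 3) → EuclideanSpace ℝ (Fin 3)} {p : ℝ → EuclideanSpace ℝ (Fin 3) → ℝ}
    (hsol : IsClassicalNSSolutionOn (Ico 0 T) ν 0 u p) (hLH : IsLerayHopfOn T ν 0 (u 0) u)
    (hdec : HasRapidSpatialDecay (u 0)) (hext : ¬ HasSmoothExtensionPast ν 0 u T) :
    ∀ t ∈ Ico 0 T, 0 < ∫ x, frobeniusNormSq (fderiv ℝ (curl (u t)) x) := by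
  intro t ht
  have ht' : (t + T) / 2 ∈ Ioo 0 T := ⟨by linarith [ht.1], by linarith [ht.2]⟩
  have htc : t ∈ Icc 0 ((t + T) / 2) := ⟨ht.1, by linarith [ht.2]⟩
  obtain ⟨q, hsolt, hut, -, -⟩ := RungReynoldsOne.stub_taoCover hν hT hsol hLH hdec ht'
  have hsm : ∀ s ∈ Icc 0 ((t + T) / 2), ContDiff ℝ ∞ (u s) := fun s hs => hsolt.contDiff_velocity hs
  have hω : HasBoundedSobolevNormsOn (Icc 0 ((t + T) / 2)) (fun s => curl (u s)) := hasBoundedSobolevNormsOn_curl hut hsm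
  have hcsm : ContDiff ℝ ∞ (curl (u t)) := contDiff_curl (hsm t htc)
  obtain ⟨C₀, hC₀⟩ := hω 0
  obtain ⟨C₁, hC₁⟩ := hω 1
  have h0 : ∫⁻ x, ‖curl (u t) x‖ₑ ^ 2 < ⊤ := by
    refine lt_of_le_of_lt (le_of_eq (lintegral_congr fun x => ?_)) ((hC₀ t htc).trans_lt ENNReal.coe_lt_top)
    rw [← ofReal_norm, ← ofReal_norm, norm_iteratedFDeriv_zero]
  have h1' : ∫⁻ x, ‖fderiv ℝ (curl (u t)) x‖ₑ ^ 2 < ⊤ := by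
    refine lt_of_le_of_lt (le_of_eq (lintegral_congr fun x => ?_)) ((hC₁ t htc).trans_lt ENNReal.coe_lt_top)
    rw [← ofReal_norm, ← norm_iteratedFDeriv_one (𝕜 := ℝ) (f := curl (u t)), ofReal_norm]
  have hP0 : 0 ≤ ∫ x, frobeniusNormSq (fderiv ℝ (curl (u t)) x) := integral_nonneg fun x => frobeniusNormSq_nonneg _
  refine lt_of_le_of_ne hP0 fun hP => ?_
  have hcD : Continuous fun x => fderiv ℝ (curl (u t)) x := hcsm.continuous_fderiv (by simp)
  have hcF : Continuous fun x => frobeniusNormSq (fderiv ℝ (curl (u t)) x) :=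
    continuous_frobeniusNormSq_fderiv hcsm (by simp)
  have hFint : Integrable fun x => frobeniusNormSq (fderiv ℝ (curl (u t)) x) := by
    refine ((integrable_sq_norm_of_lintegral_lt_top hcD h1').const_mul 3).mono' hcF.aestronglyMeasurable
      (ae_of_all _ fun x => ?_)
    rw [Real.norm_eq_abs, abs_of_nonneg (frobeniusNormSq_nonneg _)]
    exact BradshawTsai2017.frobeniusNormSq_le_three_mul_norm_sq (fderiv ℝ (curl (u t)) x)
  have hD0 : ∀ x, fderiv ℝ (curl (u t)) x = 0 := by
    intro x
    have hz := eq_zero_of_integral_eq_zero hcF (fun x => frobeniusNormSq_nonneg _) hFint hP.symm x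
    have hn : ‖fderiv ℝ (curl (u t)) x‖ ^ 2 ≤ 0 := (norm_sq_le_frobeniusNormSq _).trans hz.le
    exact norm_eq_zero.1 (by nlinarith [norm_nonneg (fderiv ℝ (curl (u t)) x)])
  have hconst : ∀ x y, curl (u t) x = curl (u t) y :=
    is_const_of_fderiv_eq_zero (hcsm.differentiable (by simp)) hD0
  have hzero := eq_zero_of_const_of_lintegral_lt_top hconst h0
  have hZ : ∫ x, ‖curl (u t) x‖ ^ 2 = 0 := by simp [hzero]
  exact absurd hZ (enstrophy_pos hν hT hsol hLH hdec hext t ht).ne'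

/-! ### The minimal coefficient is the stretching efficiency -/

/-- Real-variable core of the identification: if `a ≤ k·M·b·c` for every bound `M` of a bounded family `f` with positive
supremum, and `k` is minimal with this property, then `k = a / ((sup f)·b·c)`. [folklore] -/
theorem minimal_eq_ratio {ι : Type*} [Nonempty ι] {f : ι → ℝ} (hbdd : BddAbove (range f)) {k a b c : ℝ}
    (ha : 0 ≤ a) (hN : 0 < ⨆ i, f i) (hb : 0 < b) (hc : 0 < c)
    (hcl : ∀ M : ℝ, (∀ i, f i ≤ M) → a ≤ k * M * b * c)
    (hmin : ∀ q : ℝ, 0 ≤ q → (∀ M : ℝ, (∀ i, f i ≤ M) → a ≤ q * M * b * c) → k ≤ q) :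
    k = a / ((⨆ i, f i) * b * c) := by
  have hNb : ∀ i, f i ≤ ⨆ j, f j := fun i => le_ciSup hbdd i
  have hD : 0 < (⨆ i, f i) * b * c := mul_pos (mul_pos hN hb) hc
  have hge : a / ((⨆ i, f i) * b * c) ≤ k := by
    rw [div_le_iff₀ hD]
    calc a ≤ k * (⨆ i, f i) * b * c := hcl _ hNb
      _ = k * ((⨆ i, f i) * b * c) := by ring
  have hle : k ≤ a / ((⨆ i, f i) * b * c) := by
    refine hmin _ (div_nonneg ha hD.le) fun M hM => ?_
    have hNM : (⨆ i, f i) ≤ M := ciSup_le hM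
    have hq0 : 0 ≤ a / ((⨆ i, f i) * b * c) := div_nonneg ha hD.le
    calc a = a / ((⨆ i, f i) * b * c) * (⨆ i, f i) * b * c := by field_simp
      _ = a / ((⨆ i, f i) * b * c) * (⨆ i, f i) * (b * c) := by ring
      _ ≤ a / ((⨆ i, f i) * b * c) * M * (b * c) :=
          mul_le_mul_of_nonneg_right (mul_le_mul_of_nonneg_left hNM hq0) (mul_pos hb hc).le
      _ = a / ((⨆ i, f i) * b * c) * M * b * c := by ring
  exact le_antisymm hle hge

/-- **Identification of a minimal coefficient**: at every `t ∈ [0,T)` of a non-extending flow,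
`k₀(t) = |J(t)| / (N(t)·√Z(t)·√P(t))` with `N(t) = sup_x ‖u(t,x)‖`, `Z(t) = ∫‖curl u(t)‖²`, `P(t) = ∫|∇curl u(t)|²_F`,
`J(t) = ∫⟪curl u(t), Du(t) curl u(t)⟫` (the denominator is positive). [folklore] -/
theorem minimalCoeff_eq {ν T : ℝ} (hν : 0 < ν) (hT : 0 < T)
    {u : ℝ → EuclideanSpace ℝ (Fin 3) → EuclideanSpace ℝ (Fin 3)} {p : ℝ → EuclideanSpace ℝ (Fin 3) → ℝ}
    (hsol : IsClassicalNSSolutionOn (Ico 0 T) ν 0 u p) (hLH : IsLerayHopfOn T ν 0 (u 0) u)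
    (hdec : HasRapidSpatialDecay (u 0)) (hext : ¬ HasSmoothExtensionPast ν 0 u T)
    {k₀ : ℝ → ℝ} (hK : IsMinimalCoeff T u k₀) :
    ∀ t ∈ Ico 0 T, k₀ t = |∫ x, ⟪curl (u t) x, fderiv ℝ (u t) x (curl (u t) x)⟫_ℝ| /
      ((⨆ x, ‖u t x‖) * Real.sqrt (∫ x, ‖curl (u t) x‖ ^ 2) *
        Real.sqrt (∫ x, frobeniusNormSq (fderiv ℝ (curl (u t)) x))) := by
  intro t ht
  have hbdd := bddAbove_range_norm hν hT hsol hLH hdec t ht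
  obtain ⟨x₀, hx₀⟩ := exists_norm_pos hν hT hsol hLH hdec hext t ht
  have hN : 0 < ⨆ y, ‖u t y‖ := hx₀.trans_le (le_ciSup hbdd x₀)
  exact minimal_eq_ratio hbdd (abs_nonneg _) hN (Real.sqrt_pos.2 (enstrophy_pos hν hT hsol hLH hdec hext t ht))
    (Real.sqrt_pos.2 (palinstrophy_pos hν hT hsol hLH hdec hext t ht)) (hK.2.2.1 t ht) (hK.2.2.2 t ht)

/-! ### The registered stub -/

/-- **Z3 `stub_efficiencyContinuous`** of LINE g7-β `zone_transversality` (crux stmt-NavierStokesRegularity-26567), EXACTLY as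
registered: for a violator flow, every minimal measurable depletion coefficient `k₀` is continuous on `(0,T)`.  Proof:
`k₀ = |J|/(N√Z√P)` on `[0,T)` (`minimalCoeff_eq`; the denominator is positive by Leray's lower rate and the two Liouville
steps `enstrophy_pos`, `palinstrophy_pos`), and `J`, `N`, `Z`, `P` are continuous on `[0,T)` (`continuousOn_stretching`,
`continuousOn_iSup_norm`, `DepletionLadder.PerFlow.continuousOn_enstrophy_palinstrophy`). [folklore] -/
theorem stub_efficiencyContinuous :
    ∀ (C ν T : ℝ) (u : ℝ → EuclideanSpace ℝ (Fin 3) → EuclideanSpace ℝ (Fin 3)) (p : ℝ → EuclideanSpace ℝ (Fin 3) → ℝ),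
    IsViolator C ν T u p → ∀ k₀ : ℝ → ℝ, IsMinimalCoeff T u k₀ → ContinuousOn k₀ (Set.Ioo 0 T) := by
  intro C ν T u p hV k₀ hK
  obtain ⟨hC, hν, hT, hsol, hLH, hdec, hrate, hext, hno⟩ := hV
  have hJ := continuousOn_stretching hν hT hsol hLH hdec
  have hN := continuousOn_iSup_norm hν hT hsol hLH hdec
  obtain ⟨hZ, hP⟩ := DepletionLadder.PerFlow.continuousOn_enstrophy_palinstrophy hν hT hsol hLH hdec
  have hq : ContinuousOn (fun t => |∫ x, ⟪curl (u t) x, fderiv ℝ (u t) x (curl (u t) x)⟫_ℝ| /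
      ((⨆ x, ‖u t x‖) * Real.sqrt (∫ x, ‖curl (u t) x‖ ^ 2) *
        Real.sqrt (∫ x, frobeniusNormSq (fderiv ℝ (curl (u t)) x)))) (Ico 0 T) := by
    refine (continuous_abs.comp_continuousOn hJ).div
      ((hN.mul (Real.continuous_sqrt.comp_continuousOn hZ)).mul (Real.continuous_sqrt.comp_continuousOn hP))
      fun t ht => ?_
    have h1 : 0 < ⨆ x, ‖u t x‖ := by
      obtain ⟨x₀, hx₀⟩ := exists_norm_pos hν hT hsol hLH hdec hext t ht
      exact hx₀.trans_le (le_ciSup (bddAbove_range_norm hν hT hsol hLH hdec t ht) x₀)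
    have h2 := Real.sqrt_pos.2 (enstrophy_pos hν hT hsol hLH hdec hext t ht)
    have h3 := Real.sqrt_pos.2 (palinstrophy_pos hν hT hsol hLH hdec hext t ht)
    exact (mul_pos (mul_pos h1 h2) h3).ne'
  have hq' := hq.mono (Ioo_subset_Ico_self : Ioo 0 T ⊆ Ico 0 T)
  refine hq'.congr fun t ht => ?_
  exact minimalCoeff_eq hν hT hsol hLH hdec hext hK t (Ioo_subset_Ico_self ht)

end Summit.NavierStokesRegularity.NavierStokesRegularity.Theorems.NearExtremalTransiencePerFlow.ZoneTransversality

end
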